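import Summits.QuantumFields.YangMills.Theorems.BalabanUVNodesSpineRates
import Summits.QuantumFields.YangMills.Theorems.BalabanUVNodesN14TiltedMatching

/-!
# BalabanUVNodes ∕ node N14 = NE1′ — THE «AT-RECORD» MODULE (plan word (W2)): the K4 stub `YMDAG.UVSplit.S_N14 RRec` of the route's
# tree-home module `BalabanUVNodesSpineRates` UNFOLDED, ANTITONE in the rate-record predicate, CLOSED from the slot for EVERY `RRec`
# carrying it, GUARDED (the carrier's rate field decides), and the node's consumer faces AT THE RECORD (modules 1, 4, 5 by name)

Cell `pub-ymgap`, HUMAN RULING D-0062 (Track A at full width), seat `pub-ymgap-dag-n14-a` (-a KNIT-BY-NAME), generations 0 and 2.  THEOREMS ONLY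
(no `def`, no `def … : Prop`); imports the route's K4 module `YangMills/Theorems/BalabanUVNodesSpineRates.lean` (dagwriter text, courier dag-p2 per
chair R424 (B) ∕ R440, plan word [YMPLAN-G62-WORD-MODULES + W2] (1): `NE1pCarriers`, `RateCarriers`, `RateRecordPred`, `N14At`, `RatesAt`, `S_N14`) and
this seat's module 5 `BalabanUVNodesN14TiltedMatching` (through it modules 4 `…N14SizeBinder` and 1 `…N14DressedStability`, the NE1′ owner lineage's
`Spine/NE1p/DressedRootStrict*` — ROOT-C OF RECORD — and `DressedRootWitness`); modifies nothing; every cited lemma is used BY NAME.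

THE STUB.  `YMDAG.UVSplit.S_N14 RRec := ∀ F D g₀ os R, RRec F D g₀ os R → N14At R.ne1`, `N14At c := DressedStabilityStrict c.𝒯 c.Λ`
(`Spine/NE1p/DressedRootStrict.lean` :58), over the rate-record predicate PARAMETER `RRec : RateRecordPred N` — NODE 00's later-stage «rate carriers
OF RECORD» predicate, `--informal` until its home lands (R422 (A)(P2); restate window 2026-08-30 – 09-01).  By the plan's word (W2) the per-node
«AT-RECORD» module IS the node's CLOSER OF RECORD for its stub.  For a K4 node there is no landed `RRec` to instance; the refinement-generic
closers are therefore stated over EVERY `RRec` with the named clause, and the (W2) items read: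
* §1 (W2) READINGS: `s_N14_iff` (`Iff.rfl`: «at every rate-carrier bundle of record, ROOT-C of the dressed tower at the bundle's rate»), `n14At_iff`,
  `s_N14_antitone` (closed under refinement of `RRec`: a predicate admitting FEWER bundles is easier), `ratesAt_n14` (K4's per-string conclusion
  `RatesAt D R` carries `N14At R.ne1` as its first conjunct).
* §2 (W2) CLOSERS, REFINEMENT-GENERIC: `n14At_of_uniformLeaves`; **`s_N14_of_uniformLeaves`** — `S_N14 RRec` for EVERY `RRec` whose bundles of
  record carry the slot «∃ U : UniformConstants, U.Λ = R.ne1.Λ ∧ ∀ p K, Nonempty (BookingLeaves U …)» (END-B by name, module 1 §1); `s_N14_of_one`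
  (ONE `U` for the whole record, rates pinned into `[0, U.Λ]`); **`s_N14_of_refines`** — `S_N14 RRec` for every `RRec` refining a predicate that has it
  (so each later-stage home closes by ONE application to its refinement lemma, exactly as (W2) asks of the K1–K3 closers `s_N0x_of_refines₅∕₅C`).
* §3 (W2) GUARDS (A5 ∕ the INHABITED rider): `n14At_toyTower` (the slot and the stub's conclusion are INHABITED at the owner's toy carriers
  `⟨Unit, toyTower, 2⟩`, positive sizes — module 1 §4); `not_n14At_growing_one` ∕ `n14At_growing_quarter` (ONE tower, two rates: the `Λ` FIELD of
  `NE1pCarriers` decides `N14At`); **`not_s_N14_of_admits`** — `S_N14 RRec` is REFUTED over any `RRec` admitting a bundle without N14 (R422 DEFINITION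
  FIRST at node level: the record must pin the dressed tower AND its rate at∕above the bookings' count rate — module 1 `n14_rate_pin`);
  `s_N14_of_empty` (over a predicate admitting NO bundle the stub holds VACUOUSLY — the reason (W2) asks for the inhabited rider: K4's content then
  sits in `S_R00x`, the existence of bundles of record).
* §4 THE NODE's CONSUMER FACES AT THE RECORD: given `S_N14 RRec`, at EVERY bundle of record `R` — `finalProfile_at_record` (the final-scale profile
  `size b K ≤ A₀ρ^{K−j}` with the letter `ρ·Λ < 1`, module 4 §5 ∕ module 1 §5), `sizeBinder_dressed_at_record` (N19's `hS` ∧ `hSle` at the dressed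
  slices for every identified ledger at a count rate `Λ₀ ≤ R.ne1.Λ`, module 4 §2 — the face dag-n19-a's `N19SizeByName` consumes), and
  `oldInfluenceBudget_at_record` (the MGF road's one-run budget, module 5 §2).  The identification binders (ℓ1)–(ℓ3′) stay displayed (the LINK the
  instancing clause of `RRec` must carry between `R.ne1` and `R.u3`; dagwriter [BYIMPORT-READS] l.10483, ref-B READ #233).

HONEST FRAMING.  Kernel bookkeeping BY NAME; 0 sorry; nothing of Bałaban's densities is asserted or instantiated; NE1′ is NOT PRINTED
([Balaban1989LargeFieldII] (1.73)–(1.75) pp. 379–380 type the action only; p. 356 ll. 1–6) and NOT PROVED; the slot's leaves (the wall (w1)…(w7)) are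
discharged by nobody; no `RRec` home has landed ⇒ NOTHING here is a discharge of N14 and the count does not move.  One finite four-torus at fixed ε;
NOT infinite volume, NOT OS on ℝ⁴, NOT a mass gap, NOT Clay.
-/

noncomputable section

namespace YMDAG.N14

open Finset
open scoped BigOperators
open Literature.MathematicalPhysics.QuantumFieldTheory.Balaban1983to89
open Literature.MathematicalPhysics.QuantumFieldTheory.Balaban1983to89.T4Continuum
open Literature.MathematicalPhysics.QuantumFieldTheory.Balaban1983to89.T4RecentScale (Multiplicity)
open Summit.QuantumFields.BalabanUV.T4Continuum.NE1p.DressedRoot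
open Summit.QuantumFields.BalabanUV.T4Continuum.NE1p.DressedRootStrictSeparation
open Summit.QuantumFields.BalabanUV.T4Continuum.NE1p.TiltedMeanCrossover (OldInfluenceBudget)
open YMDAG.UVSplit

variable {N : ℕ} [NeZero N]

/-! ## §1 (W2) readings: the stub unfolded, antitone in `RRec`, and its place in K4's per-string conclusion -/

/-- **WHAT `S_N14 RRec` SAYS** (`Iff.rfl`): at every rate-carrier bundle `R` of record (for every family, datum, tuned sequence and loop string),
ROOT-C OF RECORD holds for the bundle's dressed tower at the bundle's rate: `DressedStabilityStrict R.ne1.𝒯 R.ne1.Λ`. [folklore] -/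
theorem s_N14_iff (RRec : RateRecordPred N) :
    S_N14 RRec ↔ ∀ (F : T4Family) (D : Datum F N) (g₀ : ℕ → ℝ) (os : List (ULoop F)) (R : RateCarriers N),
      RRec F D g₀ os R → DressedStabilityStrict R.ne1.𝒯 R.ne1.Λ :=
  Iff.rfl

/-- `N14At c` IS ROOT-C of record at the carriers (`Iff.rfl`). [folklore] -/
theorem n14At_iff (c : NE1pCarriers) : N14At c ↔ DressedStabilityStrict c.𝒯 c.Λ := Iff.rfl

/-- **ANTITONE IN THE RATE-RECORD PREDICATE** [bookkeeping]: if `RRec'` refines `RRec` (every bundle of record for `RRec'` is one for `RRec`), then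
`S_N14 RRec → S_N14 RRec'` — a later-stage predicate admitting fewer bundles closes from an earlier one by ONE application. [folklore] -/
theorem s_N14_antitone {RRec RRec' : RateRecordPred N}
    (href : ∀ (F : T4Family) (D : Datum F N) (g₀ : ℕ → ℝ) (os : List (ULoop F)) (R : RateCarriers N), RRec' F D g₀ os R → RRec F D g₀ os R)
    (h : S_N14 RRec) : S_N14 RRec' :=
  fun F D g₀ os R hR => h F D g₀ os R (href F D g₀ os R hR)

/-- K4's per-string conclusion `RatesAt D R` carries N14 as its FIRST conjunct (the others are N15, N16, N17, N18, N22). [folklore] -/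
theorem ratesAt_n14 {F : T4Family} {D : Datum F N} {R : RateCarriers N} (h : RatesAt D R) : N14At R.ne1 := h.1

/-! ## §2 (W2) closers, refinement-generic: from the slot «uniform leaves», for EVERY `RRec` carrying it -/

/-- **N14 AT ITS CARRIERS FROM THE SLOT** [bookkeeping]: `N14At c` for any `c : NE1pCarriers` whose dressed tower carries uniform leaves with
`U.Λ = c.Λ` (module 1's `n14_of_uniformLeaves` BY NAME — END-B `dressedStabilityStrict_of_bookingLeaves`). [folklore] -/
theorem n14At_of_uniformLeaves (c : NE1pCarriers)
    (h : ∃ U : UniformConstants, U.Λ = c.Λ ∧ ∀ p K, Nonempty (BookingLeaves U (c.𝒯.B p K) (c.𝒯.T p K))) : N14At c :=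
  n14_of_uniformLeaves c.𝒯 c.Λ h

/-- **`S_N14 RRec` FOR EVERY RATE-RECORD PREDICATE WHOSE BUNDLES OF RECORD CARRY THE SLOT** [bookkeeping] — the refinement-generic closer of
the K4 stub (nothing closed over an unpinned frame, R422): the hypothesis is ONE clause the instancing predicate can carry; its content is the wall
(w1)…(w7) instantiated on Bałaban's dressed run (NODE O). [folklore] -/
theorem s_N14_of_uniformLeaves (RRec : RateRecordPred N)
    (h : ∀ (F : T4Family) (D : Datum F N) (g₀ : ℕ → ℝ) (os : List (ULoop F)) (R : RateCarriers N), RRec F D g₀ os R →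
      ∃ U : UniformConstants, U.Λ = R.ne1.Λ ∧ ∀ p K, Nonempty (BookingLeaves U (R.ne1.𝒯.B p K) (R.ne1.𝒯.T p K))) :
    S_N14 RRec :=
  fun F D g₀ os R hR => n14At_of_uniformLeaves R.ne1 (h F D g₀ os R hR)

/-- **`S_N14 RRec` FROM ONE `U : UniformConstants` FOR THE WHOLE RECORD** [bookkeeping]: leaves at `U` for every bundle of record and the
record's rates pinned into `[0, U.Λ]` (module 1's `n14_of_uniformLeaves_of_rate_le`). [folklore] -/
theorem s_N14_of_one (RRec : RateRecordPred N) (U : UniformConstants)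
    (hL : ∀ (F : T4Family) (D : Datum F N) (g₀ : ℕ → ℝ) (os : List (ULoop F)) (R : RateCarriers N), RRec F D g₀ os R →
      ∀ p K, Nonempty (BookingLeaves U (R.ne1.𝒯.B p K) (R.ne1.𝒯.T p K)))
    (hΛ : ∀ (F : T4Family) (D : Datum F N) (g₀ : ℕ → ℝ) (os : List (ULoop F)) (R : RateCarriers N), RRec F D g₀ os R →
      0 ≤ R.ne1.Λ ∧ R.ne1.Λ ≤ U.Λ) :
    S_N14 RRec :=
  fun F D g₀ os R hR => n14_of_uniformLeaves_of_rate_le R.ne1.𝒯 U (hL F D g₀ os R hR) (hΛ F D g₀ os R hR).1 (hΛ F D g₀ os R hR).2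

/-- **`S_N14` AT EVERY REFINEMENT OF A PREDICATE CARRYING THE SLOT** [bookkeeping] — the (W2) shape «`s_N0x_of_refines…`» for K4's N14: if
`RRec₀`'s bundles carry the slot and `RRec` refines `RRec₀`, then `S_N14 RRec` (`s_N14_of_uniformLeaves` ∘ `s_N14_antitone`). [folklore] -/
theorem s_N14_of_refines (RRec₀ RRec : RateRecordPred N)
    (h₀ : ∀ (F : T4Family) (D : Datum F N) (g₀ : ℕ → ℝ) (os : List (ULoop F)) (R : RateCarriers N), RRec₀ F D g₀ os R →
      ∃ U : UniformConstants, U.Λ = R.ne1.Λ ∧ ∀ p K, Nonempty (BookingLeaves U (R.ne1.𝒯.B p K) (R.ne1.𝒯.T p K)))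
    (href : ∀ (F : T4Family) (D : Datum F N) (g₀ : ℕ → ℝ) (os : List (ULoop F)) (R : RateCarriers N), RRec F D g₀ os R → RRec₀ F D g₀ os R) :
    S_N14 RRec :=
  s_N14_antitone href (s_N14_of_uniformLeaves RRec₀ h₀)

/-! ## §3 (W2) guards: the slot is inhabited; the carrier's rate field decides; vacuity over an empty predicate -/

/-- **INHABITED** [decided toy]: at the owner's toy carriers `⟨Unit, toyTower, 2⟩` (one observable-attached family per cutoff, POSITIVE sizes, count rate
`2`) the stub's conclusion `N14At` holds — through the slot, i.e. through END-B in the strict form (module 1's `n14_toyTower_pinned`). [folklore] -/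
theorem n14At_toyTower : N14At ⟨Unit, toyTower, 2⟩ := n14_toyTower_pinned.1

/-- At the carriers `⟨Unit, growingTower, 1⟩` (the owner's doubling tower at its own count rate) `N14At` FAILS (`not_dressedStabilityStrict_growingTower`) …
[folklore] -/
theorem not_n14At_growing_one : ¬ N14At ⟨Unit, growingTower, 1⟩ :=
  not_dressedStabilityStrict_growingTower

/-- … while at `⟨Unit, growingTower, 1∕4⟩` (same tower, a rate BELOW its count rate) it HOLDS (`dressedStabilityStrict_growingTower_quarter`): the `Λ`
field of `NE1pCarriers` is content, to be pinned by the record predicate at or above the bookings' count rate (module 1's `n14_rate_pin`). [folklore] -/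
theorem n14At_growing_quarter : N14At ⟨Unit, growingTower, 1 / 4⟩ := dressedStabilityStrict_growingTower_quarter

/-- **`S_N14` IS REFUTED OVER ANY RATE-RECORD PREDICATE ADMITTING A BUNDLE WITHOUT N14** (e.g. one whose `ne1` is the doubling tower at rate `1`):
the stub is closable only over a predicate that PINS the dressed tower and its rate (R422 DEFINITION FIRST, here for K4's N14). [folklore] -/
theorem not_s_N14_of_admits (RRec : RateRecordPred N)
    (h : ∃ (F : T4Family) (D : Datum F N) (g₀ : ℕ → ℝ) (os : List (ULoop F)) (R : RateCarriers N), RRec F D g₀ os R ∧ ¬ N14At R.ne1) :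
    ¬ S_N14 RRec := by
  rintro hS
  obtain ⟨F, D, g₀, os, R, hR, hn⟩ := h
  exact hn (hS F D g₀ os R hR)

/-- **VACUITY OVER AN EMPTY PREDICATE** [bookkeeping]: a rate-record predicate admitting NO bundle has `S_N14` for free — the reason (W2) asks for the
inhabited rider; K4's existence content sits in `S_R00x` (bundles of record exist under the pins), not in `S_N14`. [folklore] -/
theorem s_N14_of_empty (RRec : RateRecordPred N)
    (h : ∀ (F : T4Family) (D : Datum F N) (g₀ : ℕ → ℝ) (os : List (ULoop F)) (R : RateCarriers N), ¬ RRec F D g₀ os R) :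
    S_N14 RRec :=
  fun F D g₀ os R hR => absurd hR (h F D g₀ os R)

/-! ## §4 The node's consumer faces AT THE RECORD (modules 1 §5, 4, 5 by name) -/

section AtRecord

variable (RRec : RateRecordPred N)

/-- **THE FINAL-SCALE PROFILE AT EVERY BUNDLE OF RECORD** [bookkeeping]: `S_N14 RRec` gives, at every `R` of record, constants `A₀, ρ ≥ 0` with
the LETTER `ρ·R.ne1.Λ < 1` and `size b K ≤ A₀ρ^{K−j}` for every booked observable-attached term of every run parameter and cutoff of `R.ne1.𝒯`
(module 4's `finalProfile_of_n14`) — what the consumers of N14 read. [folklore] -/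
theorem finalProfile_at_record (h : S_N14 RRec) {F : T4Family} {D : Datum F N} {g₀ : ℕ → ℝ} {os : List (ULoop F)}
    {R : RateCarriers N} (hR : RRec F D g₀ os R) :
    ∃ A₀ ρ : ℝ, 0 ≤ A₀ ∧ 0 ≤ ρ ∧ 0 ≤ R.ne1.Λ ∧ ρ * R.ne1.Λ < 1 ∧
      ∀ (p : R.ne1.P) (K : ℕ) (b : (R.ne1.𝒯.B p K).Birth),
        (R.ne1.𝒯.B p K).size b K ≤ A₀ * ρ ^ (K - (R.ne1.𝒯.B p K).birthScale b) :=
  finalProfile_of_n14 (h F D g₀ os R hR)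

/-- **N19's ONE-RUN SIZE BINDER AT THE DRESSED SLICES, AT EVERY BUNDLE OF RECORD** [bookkeeping]: `S_N14 RRec` and, at a bundle `R` of record, the
bookings' positional counts at a rate `Λ₀ ≤ R.ne1.Λ` (the pin (ℓ3′)) give the face of module 4 (`sizeBinder_dressed_of_n14_pinned`) for `R.ne1.𝒯`:
constants `A₀, ρ ≥ 0`, `ρ·Λ₀ < 1`, and for EVERY ledger slice family identified with the bookings (run A injective into births felt at `≤ vol` top
cubes, run B aligned, both dominated by the booked sizes) N19's `hS` ∧ `hSle` with `E₀ = 2N₀A₀`, `m = 0`, `a = ρΛ₀` — the arrow dag-n19-a's knit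
`BalabanUVNodesN19SizeByName` consumes, now keyed on the stub. [folklore] -/
theorem sizeBinder_dressed_at_record (h : S_N14 RRec) {F : T4Family} {D : Datum F N} {g₀ : ℕ → ℝ} {os : List (ULoop F)}
    {R : RateCarriers N} (hR : RRec F D g₀ os R) {Λ₀ N₀ : ℝ}
    (hcount : ∀ p K, (R.ne1.𝒯.B p K).PositionalCount fun j k => N₀ * Λ₀ ^ (k - j))
    (hN₀ : 0 ≤ N₀) (h0 : 0 ≤ Λ₀) (hle : Λ₀ ≤ R.ne1.Λ) :
    ∃ A₀ ρ : ℝ, 0 ≤ A₀ ∧ 0 ≤ ρ ∧ ρ * Λ₀ < 1 ∧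
      ∀ {Dm : Type} (wf : Finset Dm) (sc : Dm → ℕ) (eA eB : Dm → ℝ) (vol : ℝ) (K : ℕ)
        (pA : R.ne1.P) (βA : Dm → (R.ne1.𝒯.B pA K).Birth) (Q : Finset (R.ne1.𝒯.B pA K).Cube)
        (pB : R.ne1.P) (KB : ℕ) (βB : Dm → (R.ne1.𝒯.B pB KB).Birth),
        (∀ X ∈ wf, (R.ne1.𝒯.B pA K).birthScale (βA X) = sc X) →
        (∀ j, Set.InjOn βA ↑(wf.filter fun X => sc X = j)) →
        (∀ q ∈ Q, (R.ne1.𝒯.B pA K).cubeScale q = K) → ((Q.card : ℝ) ≤ vol) →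
        (∀ X ∈ wf, ∃ q ∈ Q, βA X ∈ (R.ne1.𝒯.B pA K).feltAt q) →
        (∀ X ∈ wf, KB - (R.ne1.𝒯.B pB KB).birthScale (βB X) = K - sc X) →
        (∀ X ∈ wf, |eA X| ≤ (R.ne1.𝒯.B pA K).size (βA X) K) →
        (∀ X ∈ wf, |eB X| ≤ (R.ne1.𝒯.B pB KB).size (βB X) KB) →
        ∀ j, j ≤ K → |∑ X ∈ wf with sc X = j, (eB X - eA X)| ≤ vol * ((2 * N₀ * A₀) * (ρ * Λ₀) ^ (K - j)) :=
  sizeBinder_dressed_of_n14_pinned ⟨h F D g₀ os R hR, hcount⟩ hN₀ h0 hle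

/-- **THE MGF ROAD's ONE-RUN BUDGET AT EVERY BUNDLE OF RECORD** [bookkeeping]: `S_N14 RRec` gives, at a bundle `R` of record, module 5's
`oldInfluenceBudget_of_n14` for `R.ne1.𝒯` — for every consumer datum whose slot influences are identified with and dominated by booked sizes and whose
census runs AT the bundle's rate `R.ne1.Λ`: `∃ E a, 0 ≤ E ∧ 0 ≤ a ∧ a < 1 ∧ OldInfluenceBudget …`. [folklore] -/
theorem oldInfluenceBudget_at_record (h : S_N14 RRec) {F : T4Family} {D : Datum F N} {g₀ : ℕ → ℝ} {os : List (ULoop F)}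
    {R : RateCarriers N} (hR : RRec F D g₀ os R) {ι Dm : Type*} [DecidableEq ι] (l₀ : ℝ) (T : ℕ → Finset ι)
    (Bad : ℕ → ℝ → Finset ι) (wf : ℕ → ι → Finset Dm) (sc : ℕ → Dm → ℕ) (Δ : ℕ → ℝ → ι → ℝ → Dm → ℝ)
    (wt : ℕ → ι → Dm → ℝ) {Cw vol : ℝ} (hCw : 0 ≤ Cw) (p : ℕ → ℝ → ℝ → R.ne1.P) (K' : ℕ → ℕ)
    (β : ∀ K (t : ℝ) (τ : ι) (s : ℝ), Dm → (R.ne1.𝒯.B (p K t s) (K' K)).Birth)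
    (hsc : ∀ K t τ s, ∀ X ∈ wf K τ, K' K - (R.ne1.𝒯.B (p K t s) (K' K)).birthScale (β K t τ s X) = K - sc K X)
    (hdom : ∀ K (t : ℝ), |t| ≤ l₀ → ∀ τ ∈ T K \ Bad K t, ∀ s : ℝ, |s| ≤ l₀ → ∀ X ∈ wf K τ,
      |Δ K t τ s X| ≤ (R.ne1.𝒯.B (p K t s) (K' K)).size (β K t τ s X) (K' K) * wt K τ X)
    (hwt : ∀ K τ, ∀ X ∈ wf K τ, 0 ≤ wt K τ X)
    (hM : ∀ K, ∀ τ ∈ T K, Multiplicity (wf K τ) (sc K) (wt K τ) Cw vol R.ne1.Λ K) :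
    ∃ E a : ℝ, 0 ≤ E ∧ 0 ≤ a ∧ a < 1 ∧ OldInfluenceBudget l₀ T Bad wf sc Δ vol E a :=
  oldInfluenceBudget_of_n14 (h F D g₀ os R hR) l₀ T Bad wf sc Δ wt hCw p K' β hsc hdom hwt hM

end AtRecord

end YMDAG.N14

end
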